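import Summits.BirchSwinnertonDyer.BirchSwinnertonDyer.Theorems.KatoDescentTamePotSupersingularTameFineSelmerFineUnitAnchorTamagawa
import Literature.NumberTheory.EllipticCurves.Cha2005.ShaIndexBoundIrreducible
import HarnessLib

/-!
# The fine unit-anchor road with `Ш(E′)[p] = 0` DISCHARGED by Cha's Kolyvagin bound (Heegner-index certificate)
# (route `KatoDescentPotSupersingular`, rung K9 / route `KatoDescentTamePotSupersingular`, rung KT; cell
# `bsd-potss`; crux items stmt-BirchSwinnertonDyer-19942 `WildCoatesSujathaResidue` [19386 aside] and
# stmt-BirchSwinnertonDyer-19916 `TameCoatesSujathaResidue` [19413 aside]; a `--supports … --as helper`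
# file; seat `bsd-potss-conjA-anchor` g4; ROUTE-FREE; nothing booked, BSD is not proved by any of this)

WHY. The fine UNIT-anchor road in TAMAGAWA form (`WildFineSelmerFineUnitAnchorTamagawa.missingUpperBoundAt_wild_of_fineUnitAnchor_tamagawa_analytic`,
p482042; KT twin `TameFineSelmerFineUnitAnchorTamagawa.missingUpperBoundAt_addv_of_fineUnitAnchor_tamagawa_analytic`,
p482336) reads Upper at a ♯ row `W` off ONE `p`-congruent elliptic `W′/ℚ` of ANY reduction type at `p` with
`r_an(W′) = 0`, `p ∤ #Ш(W′/ℚ)`, `p ∤ ∏ c_ℓ(W′)` and the local torsion test at `p`.  Of these, `p ∤ #Ш(W′/ℚ)` is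
the one integer a census cannot certify by point counting: for the rank-`0` NON-CM partners of the residue
rows (census of record `ROW-STATUS-conjA-anchor-g4.tsv`, verdict `EVIDENCE:AN`) only the ANALYTIC order
`Ш_an(W′)` is known.  This file replaces the hypothesis `p ∤ #Ш(W′/ℚ)` by a KOLYVAGIN CERTIFICATE through the
tree's named fact `Cha2005.thm52_padicValNat_shaOrder_le` (Cha 2005 Thm. 21 as printed by Miller 2011
Thm. 5.2 / GJPST 2009 Thm. 3.5: for non-CM `E/ℚ` of analytic rank `≤ 1`, a Heegner field `K` and Heegner
point `y_K` of infinite order, an odd prime `p ∤ d_K` with `p² ∤ N` and `ρ̄_{E,p}` irreducible,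
`ord_p #Ш(E/ℚ) ≤ 2 · ord_p [E(K) : ℤ y_K]`), in its certificate case `p ∤ [E(K) : ℤ y_K]`
(`Cha2005.padicValNat_shaOrder_eq_zero_of_not_dvd_index`): then `ord_p #Ш(W′/ℚ) = 0`, and `Ш(W′/ℚ)` is finite
by Gross–Zagier–Kolyvagin (`hGZK`, already a hypothesis of the road), so `p ∤ #Ш(W′/ℚ)`.
Irreducibility of `W′[p]` is read off the ROW (`W[p]` irreducible is a binder of the crux) along the
congruence (`irr_of_modPCongruent`, the symmetric form of
`WildFineSelmerCongruence.hasIrreducibleModPGaloisRep_of_modPCongruent`).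

* §1 `modPCongruent_symm`, `irr_of_modPCongruent` (transport of irreducibility TO the anchor).
* §2 `not_dvd_natCard_sha_of_chaCertificate` (the discharge: Cha certificate + GZK ⟹ `p ∤ #Ш(W′/ℚ)`).
* §3 row roads **`missingUpperBoundAt_wild_of_chaFineUnitAnchor`** (K9, `p = 3`) and
  **`missingUpperBoundAt_addv_of_chaFineUnitAnchor`** (KT, `Addv W p`, `p ≠ 2`).

PER-ROW DATA the certificate consumes (all displayed integers / predicates of the PARTNER `W′`, grounded per
record by the census lane): `r_an(W′) = 0`, `W′` non-CM and globally minimal, a level `N` with `p² ∤ N`, an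
imaginary quadratic `K` with the Heegner hypothesis for `N` and `p ∤ d_K`, a Heegner point `P ∈ W′(K)` of
level `N` of infinite order with `p ∤ [W′(K) : ℤ P]` (the job `cha-heegner-conjAg4` of this seat computes
Heegner indices with Sage's `heegner_index`), `p ∤ ∏ c_ℓ(W′)`, and the local torsion test at `p`.
SCOPE RIDER inherited from the fact's docstring: do NOT instantiate at `K = ℚ(i)` or `ℚ(√−3)` (the job only
uses fundamental `D < −4`).

HONEST FRAMING: kernel plumbing only; conditional on the ROW side's named facts (`hLS`, `hKatoA`, GZK,
modularity) and on the PUBLISHED fact `hCha` (size XL, no `_holds`); items 19942/19916 (19386/19413) are NOT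
closed; class-wide (A) is a named open problem. References: [Cha2005] Thm. 21 (p. 173); [Miller2011LMS]
Thm. 5.2 and §4; [GrigorovJorzaPatrikisSteinTarnita2009] §3.1 Thm. 3.5; [GreenbergLNM1716] Prop. 3.8;
[LimSujatha2018] §3 Prop. 3.2; [Kato2004Asterisque] Thm. 14.5 (3).
-/

set_option autoImplicit false
-- sibling precedent (`KatoDescentPotSupersingularAssembly.lean`): the directory name repeats the summit name
set_option linter.dupNamespace false

noncomputable section

open scoped Classical

namespace Summit.BirchSwinnertonDyer.BirchSwinnertonDyer.Theorems.FineSelmerChaAnchor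

open NumberField IsDedekindDomain Field
open WeierstrassCurve Literature.NumberTheory.EllipticCurves
  Literature.NumberTheory.EllipticCurves.GreenbergSelmer
  Literature.NumberTheory.EllipticCurves.IwasawaAlgebra
  Literature.NumberTheory.EllipticCurves.Rank1Residual
  Literature.NumberTheory.EllipticCurves.Rank1Residual.Typed
  Literature.NumberTheory.EllipticCurves.ZpExtension
  Summit.BirchSwinnertonDyer.Rank1Residual Summit.BirchSwinnertonDyer.Rank1Residual.Additive
  Summit.BirchSwinnertonDyer.Rank1Residual.O6 Summit.BirchSwinnertonDyer.Rank1Residual.Iwasawa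
  Summit.BirchSwinnertonDyer.BirchSwinnertonDyer.Theorems

/-! ## §1 Irreducibility is transported TO the anchor along the congruence -/

/-- A mod-`p` congruence is symmetric: the inverse of a `Γ_ℚ`-equivariant isomorphism `W[p] ≃ W′[p]` is
`Γ_ℚ`-equivariant. Serre (1972), §4. [folklore] -/
theorem modPCongruent_symm {W W' : WeierstrassCurve ℚ} {p : ℕ} (h : ModPCongruent W W' p) :
    ModPCongruent W' W p := by
  obtain ⟨e, he⟩ := h
  refine ⟨e.symm, fun σ Q ↦ ?_⟩
  apply e.injective
  rw [he, e.apply_symm_apply, e.apply_symm_apply]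

/-- Irreducibility of the anchor's `W′[p]` from the ROW's (`W[p]` irreducible is a binder of the crux):
transport along the congruence `W′[p] ≃ W[p]` (`Mazur1978.hasIrreducibleModPGaloisRep_of_addEquiv`).
[folklore] -/
theorem irr_of_modPCongruent {W W' : WeierstrassCurve ℚ} {p : ℕ} (hcong : ModPCongruent W' W p)
    (hirr : W.HasIrreducibleModPGaloisRep p) : W'.HasIrreducibleModPGaloisRep p := by
  obtain ⟨e, he⟩ := modPCongruent_symm hcong
  exact Mazur1978.hasIrreducibleModPGaloisRep_of_addEquiv e he hirr

/-! ## §2 The discharge: a Heegner-index certificate gives `p ∤ #Ш(W′/ℚ)` -/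

/-- **`p ∤ #Ш(E′/ℚ)` from Cha's Kolyvagin bound in the certificate case.** For a non-CM, globally minimal
`E′/ℚ` of analytic rank `≤ 1`, an imaginary quadratic `K` with the Heegner hypothesis for a level `N`,
a Heegner point `P ∈ E′(K)` of level `N` of infinite order, and an odd prime `p` with `p ∤ d_K`, `p² ∤ N`,
`ρ̄_{E′,p}` irreducible and `p ∤ [E′(K) : ℤ P]`: `ord_p #Ш(E′/ℚ) = 0` (the fact `hCha`,
`Cha2005.padicValNat_shaOrder_eq_zero_of_not_dvd_index`) and `Ш(E′/ℚ)` is finite (Gross–Zagier–Kolyvagin,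
`hGZK`), hence `p ∤ #Ш(E′/ℚ)`. [cite: Miller2011LMS, Thm. 5.2 (arXiv:1010.2431 p. 11)]
[cite: Cha2005, Thm. 21 (p. 173)] [cite: GrigorovJorzaPatrikisSteinTarnita2009, §3.1 Thm. 3.5] -/
theorem not_dvd_natCard_sha_of_chaCertificate (hCha : Cha2005.thm52_padicValNat_shaOrder_le)
    (hGZK : rank_eq_analyticRank_of_analyticRank_le_one)
    (W' : WeierstrassCurve ℚ) [W'.IsElliptic] [W'.IsGloballyMinimal] {N : ℕ} [NeZero N]
    {K : Type} [Field K] [NumberField K] (hK : IsImaginaryQuadratic K)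
    (hH : SatisfiesHeegnerHypothesis N K) {P : (W'.baseChange K).toAffine.Point}
    (hP : IsHeegnerPoint N W' K P) (hnt : ¬ IsOfFinAddOrder P) (p : ℕ) [Fact p.Prime]
    (hcm' : ¬ W'.HasCM) (hp2 : p ≠ 2) (hpD : ¬ (p : ℤ) ∣ NumberField.discr K) (hpN : ¬ p ^ 2 ∣ N)
    (hirr' : W'.HasIrreducibleModPGaloisRep p) (hr' : W'.analyticRank ≤ 1)
    (hI : ¬ p ∣ (AddSubgroup.zmultiples P).index) : ¬ p ∣ Nat.card W'.sha := by
  have hfin : Finite W'.sha := (hGZK W' hr').2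
  have h0 := Cha2005.padicValNat_shaOrder_eq_zero_of_not_dvd_index hCha W' hK hH hP hnt p hcm' hp2 hpD
    hpN hirr' hr' hI
  have hne : W'.shaOrder ≠ 0 := (shaOrder_pos W' hfin).ne'
  rcases padicValNat.eq_zero_iff.mp h0 with h | h | h
  · exact absurd h (Fact.out : p.Prime).one_lt.ne'
  · exact absurd h hne
  · exact h

/-! ## §3 The row roads with the Cha certificate in place of `p ∤ #Ш(W′/ℚ)` -/

/-- **The CHA FINE UNIT-ANCHOR road (K9, `p = 3`), row form.** Let `W/ℚ` be a row of the Conj-A crux of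
route K9 (globally minimal, `r_an = 0`, `ClassO6 W 3`, `W[3]` irreducible) and `W′/ℚ` a globally minimal
NON-CM elliptic curve with `W′[3] ≅ W[3]` — ANY reduction type at `3` — with `r_an(W′) = 0`,
`3 ∤ ∏_ℓ c_ℓ(W′)`, the local torsion test at the `v ∈ S` above `3`, and a KOLYVAGIN CERTIFICATE: a level `N`
with `9 ∤ N`, an imaginary quadratic `K` satisfying the Heegner hypothesis for `N` with `3 ∤ d_K`, and a
Heegner point `P ∈ W′(K)` of level `N` of infinite order with `3 ∤ [W′(K) : ℤ P]`. Then
`ord₃ #Ш(W) ≤ ord₃ #Ш_an(W)`. [cite: Cha2005, Thm. 21 (p. 173)] [cite: Miller2011LMS, Thm. 5.2]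
[cite: GreenbergLNM1716, Prop. 3.8 (pp. 95–96)] [cite: LimSujatha2018, §3 Prop. 3.2]
[cite: Kato2004Asterisque, Thm. 14.5 (3) and Prop. 14.16 (2)] -/
theorem missingUpperBoundAt_wild_of_chaFineUnitAnchor
    (hLS : LimSujatha2018.prop32_fineSelmerDual_moduleFinite_iff_of_torsionIso)
    (hKatoA :
      Kato2004.rankZero_padicValNat_sha_add_padicValNat_tamagawa_le_of_additive_potGood_of_irreducible_of_fineSelmerDual_fg)
    (hGZK : rank_eq_analyticRank_of_analyticRank_le_one) (hmod : hasEntireLFunction_rat)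
    (hCha : Cha2005.thm52_padicValNat_shaOrder_le)
    (W : WeierstrassCurve ℚ) [W.IsElliptic] [W.IsGloballyMinimal] [Fact (3 : ℕ).Prime]
    (hr : W.analyticRank = 0) (hO : ClassO6 W 3) (hirr : W.HasIrreducibleModPGaloisRep 3)
    (W' : WeierstrassCurve ℚ) [W'.IsElliptic] [W'.IsGloballyMinimal] (hcong : ModPCongruent W' W 3)
    (hcm' : ¬ W'.HasCM) (S : Finset (HeightOneSpectrum (𝓞 ℚ)))
    (hS : ∀ v ∉ S, ((3 : ℕ) : 𝓞 ℚ) ∉ v.asIdeal ∧ W'.HasGoodReductionAt v)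
    (hr' : W'.analyticRank = 0) (htam' : ¬ 3 ∣ W'.tamagawaProduct)
    (hloc3 : ∀ v ∈ S, ((3 : ℕ) : 𝓞 ℚ) ∈ v.asIdeal →
      ∀ x : W'.geomPrimaryTorsion 3, 3 • x = 0 → (∀ d ∈ decomp v, d • x = x) → x = 0)
    {N : ℕ} [NeZero N] (h9N : ¬ 3 ^ 2 ∣ N) {K : Type} [Field K] [NumberField K]
    (hK : IsImaginaryQuadratic K) (hH : SatisfiesHeegnerHypothesis N K)
    (h3D : ¬ (3 : ℤ) ∣ NumberField.discr K) {P : (W'.baseChange K).toAffine.Point}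
    (hP : IsHeegnerPoint N W' K P) (hnt : ¬ IsOfFinAddOrder P)
    (hI : ¬ 3 ∣ (AddSubgroup.zmultiples P).index) :
    MissingUpperBoundAt W 3 :=
  WildFineSelmerFineUnitAnchorTamagawa.missingUpperBoundAt_wild_of_fineUnitAnchor_tamagawa_analytic hLS hKatoA
    hGZK hmod W hr hO hirr W' hcong S hS hr'
    (not_dvd_natCard_sha_of_chaCertificate hCha hGZK W' hK hH hP hnt 3 hcm' (by decide)
      (by exact_mod_cast h3D) h9N (irr_of_modPCongruent hcong hirr) (by rw [hr']; exact zero_le_one) hI)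
    htam' hloc3

/-- **The CHA FINE UNIT-ANCHOR road (KT, `Addv W p`, `p ≠ 2`), row form**: the same certificate on a
globally minimal NON-CM `p`-congruent `W′` (`r_an(W′) = 0`, `p ∤ ∏ c_ℓ(W′)`, local torsion test at `p`,
level `N` with `p² ∤ N`, Heegner field `K` with `p ∤ d_K`, Heegner point of infinite order with
`p ∤ [W′(K) : ℤ P]`) gives `ord_p #Ш(W) ≤ ord_p #Ш_an(W)` at a row of the tame crux (`r_an(W) = 0`,
`Addv W p`, `ord_p j(W) ≥ 0`, `W[p]` irreducible). [cite: Cha2005, Thm. 21 (p. 173)]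
[cite: Miller2011LMS, Thm. 5.2] [cite: GreenbergLNM1716, Prop. 3.8 (pp. 95–96)]
[cite: LimSujatha2018, §3 Prop. 3.2] -/
theorem missingUpperBoundAt_addv_of_chaFineUnitAnchor
    (hLS : LimSujatha2018.prop32_fineSelmerDual_moduleFinite_iff_of_torsionIso)
    (hKatoA :
      Kato2004.rankZero_padicValNat_sha_add_padicValNat_tamagawa_le_of_additive_potGood_of_irreducible_of_fineSelmerDual_fg)
    (hGZK : rank_eq_analyticRank_of_analyticRank_le_one) (hmod : hasEntireLFunction_rat)
    (hCha : Cha2005.thm52_padicValNat_shaOrder_le)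
    (W : WeierstrassCurve ℚ) [W.IsElliptic] [W.IsGloballyMinimal] (p : ℕ) [Fact p.Prime]
    (hr : W.analyticRank = 0) (hp : p ≠ 2) (hA : Addv W p) (hj : 0 ≤ padicValRat p W.j)
    (hirr : W.HasIrreducibleModPGaloisRep p)
    (W' : WeierstrassCurve ℚ) [W'.IsElliptic] [W'.IsGloballyMinimal] (hcong : ModPCongruent W' W p)
    (hcm' : ¬ W'.HasCM) (S : Finset (HeightOneSpectrum (𝓞 ℚ)))
    (hS : ∀ v ∉ S, ((p : ℕ) : 𝓞 ℚ) ∉ v.asIdeal ∧ W'.HasGoodReductionAt v)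
    (hr' : W'.analyticRank = 0) (htam' : ¬ p ∣ W'.tamagawaProduct)
    (hlocp : ∀ v ∈ S, ((p : ℕ) : 𝓞 ℚ) ∈ v.asIdeal →
      ∀ x : W'.geomPrimaryTorsion p, p • x = 0 → (∀ d ∈ decomp v, d • x = x) → x = 0)
    {N : ℕ} [NeZero N] (hpN : ¬ p ^ 2 ∣ N) {K : Type} [Field K] [NumberField K]
    (hK : IsImaginaryQuadratic K) (hH : SatisfiesHeegnerHypothesis N K)
    (hpD : ¬ (p : ℤ) ∣ NumberField.discr K) {P : (W'.baseChange K).toAffine.Point}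
    (hP : IsHeegnerPoint N W' K P) (hnt : ¬ IsOfFinAddOrder P)
    (hI : ¬ p ∣ (AddSubgroup.zmultiples P).index) :
    MissingUpperBoundAt W p :=
  TameFineSelmerFineUnitAnchorTamagawa.missingUpperBoundAt_addv_of_fineUnitAnchor_tamagawa_analytic hLS hKatoA
    hGZK hmod W p hr hp hA hj hirr W' hcong S hS hr'
    (not_dvd_natCard_sha_of_chaCertificate hCha hGZK W' hK hH hP hnt p hcm' hp hpD hpN
      (irr_of_modPCongruent hcong hirr) (by rw [hr']; exact zero_le_one) hI)
    htam' hlocp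

end Summit.BirchSwinnertonDyer.BirchSwinnertonDyer.Theorems.FineSelmerChaAnchor

end
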